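import Summits.FinalStateConjecture.FinalStateConjecture.Theorems.PhotonSphereChannelsWindowedShellChannelsStubDyadicSplit
import Summits.FinalStateConjecture.FinalStateConjecture.Theorems.PhotonSphereChannelsWindowedShellChannelsStubLayerSplitCutoffs
import Summits.FinalStateConjecture.FinalStateConjecture.Theorems.PhotonSphereChannelsWindowedShellChannelsStubLayerSplitPieces

/-!
# Crux `WindowedShellChannels` (stmt-FinalStateConjecture-14085), line `Sketch` — stub `stub_layerSplit σ`
# (the pigeonhole layer split with a data-poor gap)

Given the shell half-width `ρ > 0`, a ratio `Λ ≥ 20`, a number of layers `N ≥ 1` and a base scale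
`Rs ≥ ρ + 1`, every finite-energy parity-`σ` unit-mass centred Regge–Wheeler solution `ψ` of the
mode `(s, ℓ)` whose Cauchy data vanish on the shell `{|x| ≤ ρ}` splits as `ψ = ψz + ψn + ψf + ψg`
into four parity-`σ` solutions of the same mode, for a scale `L = RsΛ^j`, `j < N` (so `Rs ≤ L`,
`ΛL ≤ RsΛ^N`): the ZONE piece has data in `{ρ < |x|} ∩ [−2L, 2L]`, the NEAR piece in
`(−∞, −10L)`, the FAR piece in `(ΛL/2, ∞)`, and
`E(ψz) + E(ψn) + E(ψf) ≤ (1 + 1000/N)E`, `E(ψg) ≤ (1000/N)E`.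

Proof.  Cut the data `(h, g) = (ψ(0,·), ψ_t(0,·))` with the smooth partition of unity
`χz + χn + χf + χg = 1` of `…StubLayerSplitCutoffs.exists_layerCutoffs` at the scale `L` of the
cheap layer of `…StubLayerSplitPieces.layerSplit_exists_cheap_layer` (the `N` geometric layers
`{RsΛ^j < |x| < RsΛ^{j+1}}` have Hardy costs `∫(2e₀ + 32h²/x²)` summing to `≤ 130E`, so one costs
`≤ 130E/N`); the cut pieces cost `Σ_{z,n,f} E ≤ E + cost` and `E_g ≤ cost`
(`lintegral_three_le`, `lintegral_gap_le`).  The four cut data are evolved by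
`CauchyWaveGlobal.stub_rwGlobalCauchy` and symmetrised in time with coefficients `(½, σ/2)`
(`Parity.isSolution_comb`; as in `stub_dyadicSplit`), which enforces the parity, keeps the
supports, does not increase the energy (`DyadicSplit.energyDensity_comb_zero_le`), and reproduces
`ψ` by uniqueness (`CauchyWaveGlobal.solution_unique`) because a parity-`σ` solution with `σ² = 1`
has data `((1+σ)/2·h, (1−σ)/2·g) = (h, g)`; for `σ² ≠ 1` the solution vanishes and the split is
trivial.  No definitions. [folklore in method; new]
-/

noncomputable section

set_option linter.dupNamespace false

namespace Summit.FinalStateConjecture.FinalStateConjecture.Theorems.WindowedShellChannelsSketch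

open Literature.Geometry.Lorentzian Literature.Geometry.Lorentzian.ReggeWheeler Filter Set MeasureTheory
open Literature.Analysis.PDE Literature.Analysis.Calculus Real
open Summit.FinalStateConjecture.FinalStateConjecture.Theorems.CauchyWaveGlobal
open Summit.FinalStateConjecture.FinalStateConjecture.Theorems.WindowedShellChannelsStubs
open scoped ENNReal Topology

namespace LayerSplit

/-- The constants: from `N · cost ≤ 130 E` to `cost ≤ (1000/N)E` and `E + cost ≤ (1 + 1000/N)E`
in `ℝ≥0∞`. [folklore] -/
theorem cost_bound {N : ℕ} (hN : 1 ≤ N) {c E : ℝ≥0∞} (h : (N : ℝ≥0∞) * c ≤ 130 * E) :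
    c ≤ ENNReal.ofReal (1000 / N) * E ∧ E + c ≤ ENNReal.ofReal (1 + 1000 / N) * E := by
  have hN0 : (0 : ℝ) < N := by exact_mod_cast hN
  have key : c ≤ ENNReal.ofReal (130 / N) * E := by
    have e1 : ENNReal.ofReal (1 / N) * (N : ℝ≥0∞) = 1 := by
      rw [← ENNReal.ofReal_natCast, ← ENNReal.ofReal_mul (by positivity),
        one_div_mul_cancel hN0.ne', ENNReal.ofReal_one]
    calc c = ENNReal.ofReal (1 / N) * ((N : ℝ≥0∞) * c) := by rw [← mul_assoc, e1, one_mul]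
      _ ≤ ENNReal.ofReal (1 / N) * (130 * E) := by gcongr
      _ = ENNReal.ofReal (130 / N) * E := by
          rw [← mul_assoc, show (130 : ℝ≥0∞) = ENNReal.ofReal 130 by simp,
            ← ENNReal.ofReal_mul (by positivity)]
          congr 2; ring
  have h1000 : ENNReal.ofReal (130 / N) ≤ ENNReal.ofReal (1000 / N) :=
    ENNReal.ofReal_le_ofReal (div_le_div_of_nonneg_right (by norm_num) hN0.le)
  have key' : c ≤ ENNReal.ofReal (1000 / N) * E := key.trans (mul_le_mul' h1000 le_rfl)
  refine ⟨key', ?_⟩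
  calc E + c ≤ E + ENNReal.ofReal (1000 / N) * E := add_le_add le_rfl key'
    _ = ENNReal.ofReal (1 + 1000 / N) * E := by
        rw [ENNReal.ofReal_add zero_le_one (by positivity), ENNReal.ofReal_one, add_mul, one_mul]

variable {σ : ℝ} {φ : ℝ → ℝ → ℝ}

/-- Cauchy data of the symmetrised piece `½φ(t) + (σ/2)φ(−t)`: `((1+σ)/2·A, (1−σ)/2·B)`.
[folklore] -/
theorem comb_data (hφ : ContDiff ℝ 2 (Function.uncurry φ)) {A B : ℝ → ℝ}
    (hA : ∀ x, φ 0 x = A x) (hB : ∀ x, deriv (fun τ => φ τ x) 0 = B x) (x : ℝ) :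
    (fun t x => 2⁻¹ * φ t x + σ * 2⁻¹ * φ (-t) x) 0 x = (2⁻¹ + σ * 2⁻¹) * A x ∧
      deriv (fun τ => (fun t x => 2⁻¹ * φ t x + σ * 2⁻¹ * φ (-t) x) τ x) 0
        = (2⁻¹ - σ * 2⁻¹) * B x := by
  constructor
  · show 2⁻¹ * φ 0 x + σ * 2⁻¹ * φ (-0) x = _
    rw [neg_zero, hA]; ring
  · show deriv (fun τ => 2⁻¹ * φ τ x + σ * 2⁻¹ * φ (-τ) x) 0 = _
    rw [Parity.deriv_comb_fst hφ, neg_zero, hB]; ring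

/-- The `t`-slices of the symmetrised piece are differentiable at `t = 0`. [folklore] -/
theorem comb_differentiableAt (hφ : ContDiff ℝ 2 (Function.uncurry φ)) (x : ℝ) :
    DifferentiableAt ℝ (fun τ => (fun t x => 2⁻¹ * φ t x + σ * 2⁻¹ * φ (-t) x) τ x) 0 :=
  ((Parity.contDiff_uncurry_comb hφ 2⁻¹ (σ * 2⁻¹)).comp
    (contDiff_id.prodMk contDiff_const)).differentiable (by norm_num) 0

/-- The energy of the symmetrised piece at `t = 0` is at most the data energy of `(A, B)`.
[folklore] -/
theorem totalEnergy_comb_le {V : ℝ → ℝ} (hV0 : ∀ x, 0 ≤ V x) (hφ : ContDiff ℝ 2 (Function.uncurry φ))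
    {A B : ℝ → ℝ} (hA : ∀ x, φ 0 x = A x) (hB : ∀ x, deriv (fun τ => φ τ x) 0 = B x)
    (hσ : σ ^ 2 = 1) :
    totalEnergy V (fun t x => 2⁻¹ * φ t x + σ * 2⁻¹ * φ (-t) x) 0
      ≤ ∫⁻ x, ENNReal.ofReal (B x ^ 2 + deriv A x ^ 2 + V x * A x ^ 2) := by
  unfold totalEnergy
  exact lintegral_mono fun x => ENNReal.ofReal_le_ofReal
    (DyadicSplit.energyDensity_comb_zero_le hV0 hφ hA hB hσ x)

end LayerSplit

open LayerSplit DyadicSplit WindowedShellChannelsSplit NearHalfShare in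
/-- **Stub `stub_layerSplit σ` (line `Sketch`): the pigeonhole layer split with a data-poor gap.**
See the module docstring. [folklore in method; new] -/
theorem stub_layerSplit (σ : ℝ) : ∀ (s ℓ : ℕ), s ≤ ℓ → ∀ ρ : ℝ, 0 < ρ → ∀ Λ : ℝ, 20 ≤ Λ → ∀ N : ℕ, 1 ≤ N →
    ∀ Rs : ℝ, ρ + 1 ≤ Rs → ∀ ψ : ℝ → ℝ → ℝ,
      IsRWSolution 1 s ℓ (tortoiseRadius one_pos 0) ψ → (∀ t x, ψ (-t) x = σ * ψ t x) →
      CauchyDataSupportedOn ψ {x : ℝ | ρ < |x|} →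
      totalEnergy (linePotential 1 s ℓ (tortoiseRadius one_pos 0)) ψ 0 ≠ ⊤ →
      ∃ L : ℝ, Rs ≤ L ∧ Λ * L ≤ Rs * Λ ^ N ∧ ∃ ψz ψn ψf ψg : ℝ → ℝ → ℝ,
        IsRWSolution 1 s ℓ (tortoiseRadius one_pos 0) ψz ∧ IsRWSolution 1 s ℓ (tortoiseRadius one_pos 0) ψn ∧
        IsRWSolution 1 s ℓ (tortoiseRadius one_pos 0) ψf ∧ IsRWSolution 1 s ℓ (tortoiseRadius one_pos 0) ψg ∧
        (∀ t x, ψ t x = ψz t x + ψn t x + ψf t x + ψg t x) ∧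
        (∀ t x, ψz (-t) x = σ * ψz t x) ∧ (∀ t x, ψn (-t) x = σ * ψn t x) ∧
        (∀ t x, ψf (-t) x = σ * ψf t x) ∧ (∀ t x, ψg (-t) x = σ * ψg t x) ∧
        CauchyDataSupportedOn ψz ({x : ℝ | ρ < |x|} ∩ Icc (-(2 * L)) (2 * L)) ∧
        CauchyDataSupportedOn ψn (Iio (-(10 * L))) ∧
        CauchyDataSupportedOn ψf (Ioi (Λ * L / 2)) ∧
        totalEnergy (linePotential 1 s ℓ (tortoiseRadius one_pos 0)) ψz 0
            + totalEnergy (linePotential 1 s ℓ (tortoiseRadius one_pos 0)) ψn 0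
            + totalEnergy (linePotential 1 s ℓ (tortoiseRadius one_pos 0)) ψf 0
          ≤ ENNReal.ofReal (1 + 1000 / N) * totalEnergy (linePotential 1 s ℓ (tortoiseRadius one_pos 0)) ψ 0 ∧
        totalEnergy (linePotential 1 s ℓ (tortoiseRadius one_pos 0)) ψg 0
          ≤ ENNReal.ofReal (1000 / N) * totalEnergy (linePotential 1 s ℓ (tortoiseRadius one_pos 0)) ψ 0 := by
  intro s ℓ hsℓ ρ hρ Λ hΛ N hN Rs hRs ψ hψ hpar hsupp _hfin
  set r := tortoiseRadius one_pos (0 : ℝ) with hrdef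
  have hr : IsTortoiseRadius 1 r 0 := isTortoiseRadius_tortoiseRadius one_pos 0
  set V := linePotential 1 s ℓ r with hVdef
  have hVd : Differentiable ℝ V := RW.differentiable_linePotential hr s ℓ
  have hV0 : ∀ x, 0 ≤ V x := fun x => (RW.linePotential_pos hr hsℓ x).le
  have hVc : Continuous V := hVd.continuous
  have hΛ1 : 1 ≤ Λ := by linarith
  have hRs0 : 0 < Rs := by linarith
  have hC2 : ContDiff ℝ 2 (Function.uncurry ψ) := hψ.1
  -- degenerate parities
  by_cases hσ : σ ^ 2 = 1
  swap
  · have hz : ∀ t x, ψ t x = 0 := eq_zero_of_parity hpar hσ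
    have hsupp' : ∀ S : Set ℝ, CauchyDataSupportedOn ψ S := by
      intro S x _
      refine ⟨hz 0 x, ?_⟩
      rw [show (fun τ => ψ τ x) = fun _ => (0:ℝ) from funext fun τ => hz τ x]
      simp
    have hE0 : totalEnergy V ψ 0 = 0 := totalEnergy_eq_zero_of_eq_zero hz 0
    refine ⟨Rs, le_rfl, ?_, ψ, ψ, ψ, ψ, hψ, hψ, hψ, hψ, fun t x => by simp [hz], hpar, hpar, hpar,
      hpar, hsupp' _, hsupp' _, hsupp' _, ?_, ?_⟩
    · rw [mul_comm]
      exact mul_le_mul_of_nonneg_left (le_self_pow₀ hΛ1 (by omega)) hRs0.le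
    · rw [hE0]; simp
    · rw [hE0]; simp
  -- the data
  set h : ℝ → ℝ := ψ 0 with hhdef
  set g : ℝ → ℝ := fun x => deriv (fun τ => ψ τ x) 0 with hgdef
  have hhC : ContDiff ℝ 2 h := hC2.comp (contDiff_const.prodMk contDiff_id)
  have hhC1 : ContDiff ℝ 1 h := hhC.of_le (by norm_num)
  have hhd : Differentiable ℝ h := hhC1.differentiable (by norm_num)
  have hgC : ContDiff ℝ 1 g := contDiff_one_velocityDatum hC2
  have hdata0 : ∀ x, |x| ≤ ρ → h x = 0 ∧ g x = 0 := fun x hx =>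
    hsupp x (by simpa only [mem_setOf_eq, not_lt] using hx)
  have hE : totalEnergy V ψ 0 = ∫⁻ x, ENNReal.ofReal (g x ^ 2 + deriv h x ^ 2 + V x * h x ^ 2) := by
    unfold totalEnergy energyDensity; rfl
  -- parity of the data: `h = σh`, `−g = σg`
  have hpar0 : ∀ x, (2⁻¹ + σ * 2⁻¹) * h x = h x := by
    intro x
    have e := hpar 0 x
    rw [neg_zero] at e
    have : h x = σ * h x := e
    linear_combination (-(2⁻¹ : ℝ)) * this
  have hpar1 : ∀ x, (2⁻¹ - σ * 2⁻¹) * g x = g x := by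
    intro x
    have e1 : (fun τ => ψ (-τ) x) = fun τ => σ * ψ τ x := funext fun τ => hpar τ x
    have e2 : deriv (fun τ => ψ (-τ) x) 0 = deriv (fun τ => σ * ψ τ x) 0 := by rw [e1]
    rw [deriv_comp_neg (fun τ => ψ τ x) 0, neg_zero, deriv_const_mul_field] at e2
    have : -g x = σ * g x := e2
    linear_combination (2⁻¹ : ℝ) * this
  -- the cheap layer and the scale `L = Rs Λ^j`
  obtain ⟨j, hjN, hcost⟩ := layerSplit_exists_cheap_layer V h g hVc hV0 hhC1 hgC.continuous ρ hρ
    (fun x hx => (hdata0 x hx).1) Λ hΛ1 Rs hRs0 N hN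
  set L : ℝ := Rs * Λ ^ j with hL
  have hL0 : 0 < L := by positivity
  have hRsL : Rs ≤ L := le_mul_of_one_le_right hRs0.le (one_le_pow₀ hΛ1)
  have hΛL : Λ * L ≤ Rs * Λ ^ N := by
    rw [hL, mul_comm, mul_assoc, ← pow_succ]
    exact mul_le_mul_of_nonneg_left (pow_le_pow_right₀ hΛ1 hjN) hRs0.le
  -- the cutoffs
  obtain ⟨χz, χn, χf, χg, hCz, hCn, hCf, hCg, hsum4, h01, hz0, hn0, hf0, hg0, hd, hoff⟩ :=
    exists_layerCutoffs Λ L hL0 hΛ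
  have hχ2 : ∀ {χ : ℝ → ℝ}, ContDiff ℝ (⊤ : ℕ∞) χ → ContDiff ℝ 2 χ := fun hχ => hχ.of_le (by norm_cast)
  have hχ1 : ∀ {χ : ℝ → ℝ}, ContDiff ℝ (⊤ : ℕ∞) χ → ContDiff ℝ 1 χ := fun hχ => hχ.of_le (by norm_cast)
  have hχd : ∀ {χ : ℝ → ℝ}, ContDiff ℝ (⊤ : ℕ∞) χ → Differentiable ℝ χ := fun hχ =>
    (hχ1 hχ).differentiable (by norm_num)
  -- cut data and the four solutions
  have hAC : ∀ {χ : ℝ → ℝ}, ContDiff ℝ (⊤ : ℕ∞) χ → ContDiff ℝ 2 (fun y => χ y * h y) :=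
    fun hχ => (hχ2 hχ).mul hhC
  have hBC : ∀ {χ : ℝ → ℝ}, ContDiff ℝ (⊤ : ℕ∞) χ → ContDiff ℝ 1 (fun y => χ y * g y) :=
    fun hχ => (hχ1 hχ).mul hgC
  obtain ⟨φz, hφz, hφz0, hφz1⟩ := stub_rwGlobalCauchy 1 r 0 hr s ℓ hsℓ _ _ (hAC hCz) (hBC hCz)
  obtain ⟨φn, hφn, hφn0, hφn1⟩ := stub_rwGlobalCauchy 1 r 0 hr s ℓ hsℓ _ _ (hAC hCn) (hBC hCn)
  obtain ⟨φf, hφf, hφf0, hφf1⟩ := stub_rwGlobalCauchy 1 r 0 hr s ℓ hsℓ _ _ (hAC hCf) (hBC hCf)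
  obtain ⟨φg, hφg, hφg0, hφg1⟩ := stub_rwGlobalCauchy 1 r 0 hr s ℓ hsℓ _ _ (hAC hCg) (hBC hCg)
  set Pz : ℝ → ℝ → ℝ := fun t x => 2⁻¹ * φz t x + σ * 2⁻¹ * φz (-t) x with hPz
  set Pn : ℝ → ℝ → ℝ := fun t x => 2⁻¹ * φn t x + σ * 2⁻¹ * φn (-t) x with hPn
  set Pf : ℝ → ℝ → ℝ := fun t x => 2⁻¹ * φf t x + σ * 2⁻¹ * φf (-t) x with hPf
  set Pg : ℝ → ℝ → ℝ := fun t x => 2⁻¹ * φg t x + σ * 2⁻¹ * φg (-t) x with hPg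
  have hPzS : IsRWSolution 1 s ℓ r Pz := Parity.isSolution_comb hφz 2⁻¹ (σ * 2⁻¹)
  have hPnS : IsRWSolution 1 s ℓ r Pn := Parity.isSolution_comb hφn 2⁻¹ (σ * 2⁻¹)
  have hPfS : IsRWSolution 1 s ℓ r Pf := Parity.isSolution_comb hφf 2⁻¹ (σ * 2⁻¹)
  have hPgS : IsRWSolution 1 s ℓ r Pg := Parity.isSolution_comb hφg 2⁻¹ (σ * 2⁻¹)
  have hdz : ∀ x, Pz 0 x = (2⁻¹ + σ * 2⁻¹) * (χz x * h x) ∧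
      deriv (fun τ => Pz τ x) 0 = (2⁻¹ - σ * 2⁻¹) * (χz x * g x) := comb_data hφz.1 hφz0 hφz1
  have hdn : ∀ x, Pn 0 x = (2⁻¹ + σ * 2⁻¹) * (χn x * h x) ∧
      deriv (fun τ => Pn τ x) 0 = (2⁻¹ - σ * 2⁻¹) * (χn x * g x) := comb_data hφn.1 hφn0 hφn1
  have hdf : ∀ x, Pf 0 x = (2⁻¹ + σ * 2⁻¹) * (χf x * h x) ∧
      deriv (fun τ => Pf τ x) 0 = (2⁻¹ - σ * 2⁻¹) * (χf x * g x) := comb_data hφf.1 hφf0 hφf1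
  have hdg : ∀ x, Pg 0 x = (2⁻¹ + σ * 2⁻¹) * (χg x * h x) ∧
      deriv (fun τ => Pg τ x) 0 = (2⁻¹ - σ * 2⁻¹) * (χg x * g x) := comb_data hφg.1 hφg0 hφg1
  -- supports of the un-symmetrised solutions
  have hsz : CauchyDataSupportedOn φz ({x : ℝ | ρ < |x|} ∩ Icc (-(2 * L)) (2 * L)) := by
    intro x hx
    rw [hφz0, hφz1]
    rw [mem_inter_iff, not_and_or] at hx
    rcases hx with hx | hx
    · have hab := hdata0 x (by simpa only [mem_setOf_eq, not_lt] using hx)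
      simp only [hab, mul_zero, and_self]
    · have hx' : 2 * L ≤ |x| := by
        simp only [mem_Icc, not_and_or, not_le] at hx
        rcases hx with h1 | h1
        · rw [abs_of_neg (by linarith)]; linarith
        · rw [abs_of_pos (by linarith)]; linarith
      simp only [hz0 x hx', zero_mul, and_self]
  have hsn : CauchyDataSupportedOn φn (Iio (-(10 * L))) := by
    intro x hx
    rw [hφn0, hφn1]
    simp only [hn0 x (not_lt.1 hx), zero_mul, and_self]
  have hsf : CauchyDataSupportedOn φf (Ioi (Λ * L / 2)) := by
    intro x hx
    rw [hφf0, hφf1]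
    simp only [hf0 x (not_lt.1 hx), zero_mul, and_self]
  refine ⟨L, hRsL, hΛL, Pz, Pn, Pf, Pg, hPzS, hPnS, hPfS, hPgS, ?_, comb_parity hσ, comb_parity hσ,
    comb_parity hσ, comb_parity hσ, Parity.supported_comb hφz.1 hsz _ _,
    Parity.supported_comb hφn.1 hsn _ _, Parity.supported_comb hφf.1 hsf _ _, ?_, ?_⟩
  · -- the decomposition, by uniqueness
    set S : ℝ → ℝ → ℝ := fun t x => Pz t x + Pn t x + Pf t x + Pg t x with hS
    have hSsol : IsRWSolution 1 s ℓ r S := by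
      have h1 := isSolution_lincomb (isSolution_lincomb (isSolution_lincomb hPzS hPnS 1 1) hPfS 1 1)
        hPgS 1 1
      have e : (fun t x => 1 * (fun t x => 1 * (fun t x => 1 * Pz t x + 1 * Pn t x) t x + 1 * Pf t x) t x
          + 1 * Pg t x) = S := by
        funext t x; simp only [hS, one_mul]
      rw [e] at h1; exact h1
    have hdPz : ∀ x, DifferentiableAt ℝ (fun τ => Pz τ x) 0 := comb_differentiableAt hφz.1
    have hdPn : ∀ x, DifferentiableAt ℝ (fun τ => Pn τ x) 0 := comb_differentiableAt hφn.1
    have hdPf : ∀ x, DifferentiableAt ℝ (fun τ => Pf τ x) 0 := comb_differentiableAt hφf.1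
    have hdPg : ∀ x, DifferentiableAt ℝ (fun τ => Pg τ x) 0 := comb_differentiableAt hφg.1
    have hd2 : ∀ x, DifferentiableAt ℝ (fun τ => Pz τ x + Pn τ x) 0 := fun x =>
      (hdPz x).add (hdPn x)
    have hd3 : ∀ x, DifferentiableAt ℝ (fun τ => Pz τ x + Pn τ x + Pf τ x) 0 := fun x =>
      (hd2 x).add (hdPf x)
    have key : ψ = S := by
      refine solution_unique hVd hV0 hψ hSsol (fun x => ?_) (fun x => ?_)
      · show ψ 0 x = Pz 0 x + Pn 0 x + Pf 0 x + Pg 0 x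
        rw [(hdz x).1, (hdn x).1, (hdf x).1, (hdg x).1]
        have hsum := hsum4 x
        calc ψ 0 x = h x := rfl
          _ = (2⁻¹ + σ * 2⁻¹) * ((χz x + χn x + χf x + χg x) * h x) := by rw [hsum, one_mul, hpar0]
          _ = _ := by ring
      · show deriv (fun τ => ψ τ x) 0 = deriv (fun τ => Pz τ x + Pn τ x + Pf τ x + Pg τ x) 0
        rw [deriv_fun_add (hd3 x) (hdPg x), deriv_fun_add (hd2 x) (hdPf x),
          deriv_fun_add (hdPz x) (hdPn x),
          (hdz x).2, (hdn x).2, (hdf x).2, (hdg x).2]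
        have hsum := hsum4 x
        calc deriv (fun τ => ψ τ x) 0 = g x := rfl
          _ = (2⁻¹ - σ * 2⁻¹) * ((χz x + χn x + χf x + χg x) * g x) := by rw [hsum, one_mul, hpar1]
          _ = _ := by ring
    intro t x
    exact congrFun (congrFun key t) x
  · -- energy of the three outer pieces
    have h3 := lintegral_three_le (L := L) (Λ := Λ) hVc hV0 hhC1 hgC.continuous (hχd hCz) (hχd hCn)
      (hχd hCf) h01 (fun x => (hd x).1) (fun x hx => ⟨(hoff x hx).1, (hoff x hx).2.1, (hoff x hx).2.2.1⟩)
    have hb := (cost_bound hN hcost).2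
    rw [hE]
    refine le_trans ?_ (h3.trans hb)
    exact add_le_add (add_le_add (totalEnergy_comb_le hV0 hφz.1 hφz0 hφz1 hσ)
      (totalEnergy_comb_le hV0 hφn.1 hφn0 hφn1 hσ)) (totalEnergy_comb_le hV0 hφf.1 hφf0 hφf1 hσ)
  · -- energy of the gap piece
    have hg01 : ∀ x, 0 ≤ χg x ∧ χg x ≤ 1 := by
      intro x
      obtain ⟨a, b, c, d⟩ := h01 x
      have e := hsum4 x
      constructor <;> linarith
    have h4 := lintegral_gap_le (L := L) (Λ := Λ) (g := g) hV0 hhd (hχd hCg) (fun x => (hg01 x).1)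
      (fun x => (hg01 x).2) (fun x => (hd x).2) (fun x hx => ⟨hg0 x hx, (hoff x hx).2.2.2⟩)
    have hb := (cost_bound hN hcost).1
    rw [hE]
    exact (totalEnergy_comb_le hV0 hφg.1 hφg0 hφg1 hσ).trans (h4.trans hb)

end Summit.FinalStateConjecture.FinalStateConjecture.Theorems.WindowedShellChannelsSketch

end
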